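import Mathlib.Topology.MetricSpace.Pseudo.Defs
import Mathlib.Topology.MetricSpace.Basic
import Mathlib.Data.Nat.Find
import HarnessLib

/-!
# Route `ExtremiserTransience`, crux `RegularisedNearPlateauStability` (stmt-NavierStokesRegularity-28317),
# LINE g8-α «sparse bang-bang»: CLUSTERING OF A BOUNDED-CARDINALITY NET (pure metric combinatorics)

`--supports stmt-NavierStokesRegularity-28317` (helper). Author: prover seat `ns-net-p2` (g2).

Step P1 of the line covers the half-top set `{‖v‖ ≥ M/2}` of a sparse field by boundedly many balls of comparable
radii whose threefold dilates are pairwise disjoint.  The metric-combinatorial half of that step is isolated here,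
for an arbitrary pseudo-metric space:

* `exists_separated_clusters` — SINGLE-LINKAGE CLUSTERING: a finite set `P` with `card P ≤ m` and a scale `r > 0`
  admit centres `C ⊆ P` and radii `ρ_c ∈ [r, 7^m r]` such that every `r`-ball around a point of `P` lies in some
  `B(c, ρ_c)` (`dist p c + r ≤ ρ_c`) and distinct cluster balls have DISJOINT THREEFOLD DILATES
  (`3ρ_c + 3ρ_{c'} ≤ dist c c'`).  Induction on `m`: either all mutual distances are `≥ 6r` (take `C = P`, `ρ ≡ r`),
  or two points are `6r`-close — drop one and cluster the rest at scale `7r`.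
* `exists_maximal_separated_net` — if every finite `s`-separated (distinct points at distance `≥ s`) subset of a
  set `T` has at most `m₀` points, then
  some finite `s`-separated `P ⊆ T` is an `s`-NET of `T` (`T ⊆ ⋃_{p ∈ P} B(p, s)`; maximal cardinality).
* `exists_cluster_cover` — the two combined: `T` is covered by `≤ m₀` balls `B(c_i, ρ_i)`, `c_i ∈ T`,
  `s ≤ ρ_i ≤ 2·7^{m₀}·s`, with pairwise disjoint threefold dilates.

HONEST FRAMING: finite combinatorics in a metric space; nothing about Navier–Stokes is proved; no summit is proved by a
line. [folklore]
-/

open Set Metric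

namespace Summit.NavierStokesRegularity.NavierStokesRegularity.Theorems

-- the problem directory repeats the summit name (`NavierStokesRegularity/NavierStokesRegularity`)
set_option linter.dupNamespace false

namespace DepletionLadder.KStar.BangBang

variable {X : Type*} [PseudoMetricSpace X]

/-- **Single-linkage clustering.** For a finite set `P` with `card P ≤ m` and `r > 0` there are centres `C ⊆ P` and
radii `ρ` with `r ≤ ρ c ≤ 7^m·r`, every `p ∈ P` having a centre `c ∈ C` with `dist p c + r ≤ ρ c`, and
`3ρ c + 3ρ c' ≤ dist c c'` for distinct centres. [folklore] -/
theorem exists_separated_clusters [DecidableEq X] :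
    ∀ (m : ℕ) (P : Finset X) (r : ℝ), P.card ≤ m → 0 < r →
      ∃ (C : Finset X) (ρ : X → ℝ), C ⊆ P ∧ (∀ c ∈ C, r ≤ ρ c ∧ ρ c ≤ 7 ^ m * r) ∧
        (∀ p ∈ P, ∃ c ∈ C, dist p c + r ≤ ρ c) ∧
        (∀ c ∈ C, ∀ c' ∈ C, c ≠ c' → 3 * ρ c + 3 * ρ c' ≤ dist c c') := by
  intro m
  induction m with
  | zero =>
    intro P r hP hr
    have hP0 : P = ∅ := Finset.card_eq_zero.1 (Nat.le_zero.1 hP)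
    refine ⟨∅, fun _ => r, Finset.empty_subset _, fun c hc => ?_, fun p hp => ?_, fun c hc => ?_⟩
    · simp at hc
    · rw [hP0] at hp; simp at hp
    · simp at hc
  | succ m ih =>
    intro P r hP hr
    by_cases hsep : ∀ p ∈ P, ∀ q ∈ P, p ≠ q → 6 * r ≤ dist p q
    · refine ⟨P, fun _ => r, Finset.Subset.refl _, fun c _ => ⟨le_rfl, ?_⟩, fun p hp => ⟨p, hp, ?_⟩,
        fun c hc c' hc' hne => ?_⟩
      · have h7 : (1 : ℝ) ≤ 7 ^ (m + 1) := one_le_pow₀ (by norm_num)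
        nlinarith
      · rw [dist_self]; linarith
      · have := hsep c hc c' hc' hne; linarith
    · push Not at hsep
      obtain ⟨p, hp, q, hq, hne, hlt⟩ := hsep
      have hcard : (P.erase q).card ≤ m := by
        rw [Finset.card_erase_of_mem hq]
        omega
      obtain ⟨C, ρ, hCP, hρ, hcov, hdisj⟩ := ih (P.erase q) (7 * r) hcard (by linarith)
      refine ⟨C, ρ, hCP.trans (Finset.erase_subset _ _), fun c hc => ?_, fun x hx => ?_, hdisj⟩
      · obtain ⟨h1, h2⟩ := hρ c hc
        refine ⟨by linarith, ?_⟩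
        rw [pow_succ]; linarith
      · by_cases hxq : x = q
        · subst hxq
          have hp' : p ∈ P.erase x := Finset.mem_erase.2 ⟨hne, hp⟩
          obtain ⟨c, hc, hpc⟩ := hcov p hp'
          refine ⟨c, hc, ?_⟩
          have htri : dist x c ≤ dist x p + dist p c := dist_triangle _ _ _
          rw [dist_comm x p] at htri
          linarith
        · obtain ⟨c, hc, hxc⟩ := hcov x (Finset.mem_erase.2 ⟨hxq, hx⟩)
          exact ⟨c, hc, by linarith⟩

/-- **Maximal separated net.** If every finite `s`-separated subset of `T` has at most `m₀` points, some finite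
`s`-separated `P ⊆ T` with `card P ≤ m₀` is an `s`-net: `T ⊆ ⋃_{p ∈ P} B(p, s)`. [folklore] -/
theorem exists_maximal_separated_net [DecidableEq X] (T : Set X) {s : ℝ} (hs : 0 < s) (m₀ : ℕ)
    (hbound : ∀ P : Finset X, (↑P : Set X) ⊆ T → (∀ p ∈ P, ∀ q ∈ P, p ≠ q → s ≤ dist p q) → P.card ≤ m₀) :
    ∃ P : Finset X, (↑P : Set X) ⊆ T ∧ (∀ p ∈ P, ∀ q ∈ P, p ≠ q → s ≤ dist p q) ∧ P.card ≤ m₀ ∧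
      T ⊆ ⋃ p ∈ P, ball p s := by
  classical
  set Q : ℕ → Prop := fun n => ∃ P : Finset X, (↑P : Set X) ⊆ T ∧ (∀ p ∈ P, ∀ q ∈ P, p ≠ q → s ≤ dist p q) ∧
    P.card = n with hQ
  have hQ0 : Q 0 := ⟨∅, by simp, fun p hp => by simp at hp, Finset.card_empty⟩
  set n₀ := Nat.findGreatest Q m₀ with hn₀
  have hQn : Q n₀ := Nat.findGreatest_spec (Nat.zero_le m₀) hQ0
  obtain ⟨P, hPT, hPs, hPc⟩ := hQn
  have hn₀le : n₀ ≤ m₀ := Nat.findGreatest_le m₀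
  refine ⟨P, hPT, hPs, hPc ▸ hn₀le, fun x hx => ?_⟩
  by_contra hxcov
  -- `x` is `s`-far from every point of `P`, so `insert x P` is a larger separated subset of `T`
  have hfar : ∀ p ∈ P, s ≤ dist x p := by
    intro p hp
    by_contra h
    exact hxcov (mem_iUnion₂.2 ⟨p, hp, mem_ball.2 (lt_of_not_ge h)⟩)
  have hxP : x ∉ P := fun hxP' => hxcov (mem_iUnion₂.2 ⟨x, hxP', mem_ball_self hs⟩)
  have hsep' : ∀ p ∈ insert x P, ∀ q ∈ insert x P, p ≠ q → s ≤ dist p q := by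
    intro p hp q hq hpq
    rcases Finset.mem_insert.1 hp with rfl | hp'
    · rcases Finset.mem_insert.1 hq with rfl | hq'
      · exact absurd rfl hpq
      · exact hfar q hq'
    · rcases Finset.mem_insert.1 hq with rfl | hq'
      · rw [dist_comm]; exact hfar p hp'
      · exact hPs p hp' q hq' hpq
  have hsub' : (↑(insert x P) : Set X) ⊆ T := by
    rw [Finset.coe_insert]
    exact insert_subset hx hPT
  have hcard' : (insert x P).card = n₀ + 1 := by rw [Finset.card_insert_of_notMem hxP, hPc]
  have hQ' : Q (n₀ + 1) := ⟨insert x P, hsub', hsep', hcard'⟩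
  have hle' : n₀ + 1 ≤ m₀ := by
    have := hbound (insert x P) hsub' hsep'
    rw [hcard'] at this
    exact this
  exact Nat.findGreatest_is_greatest (Nat.lt_succ_self n₀) hle' hQ'

/-- **Cluster cover.** If every finite `s`-separated subset of `T` has at most `m₀` points (`s > 0`), then `T` is
covered by at most `m₀` balls `B(c_i, ρ_i)` with centres in `T`, radii `s ≤ ρ_i ≤ 2·7^{m₀}·s`, and pairwise
disjoint threefold dilates. [folklore] -/
theorem exists_cluster_cover [DecidableEq X] (T : Set X) {s : ℝ} (hs : 0 < s) (m₀ : ℕ)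
    (hbound : ∀ P : Finset X, (↑P : Set X) ⊆ T → (∀ p ∈ P, ∀ q ∈ P, p ≠ q → s ≤ dist p q) → P.card ≤ m₀) :
    ∃ (k : ℕ) (c : Fin k → X) (ρ : Fin k → ℝ), k ≤ m₀ ∧ (∀ i, c i ∈ T) ∧ (∀ i, s ≤ ρ i ∧ ρ i ≤ 2 * 7 ^ m₀ * s) ∧
      T ⊆ (⋃ i, ball (c i) (ρ i)) ∧ ∀ i j, i ≠ j → Disjoint (ball (c i) (3 * ρ i)) (ball (c j) (3 * ρ j)) := by
  obtain ⟨P, hPT, hPs, hPc, hnet⟩ := exists_maximal_separated_net T hs m₀ hbound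
  obtain ⟨C, ρ, hCP, hρ, hcov, hdisj⟩ := exists_separated_clusters m₀ P s hPc hs
  -- enumerate `C`
  set k := C.card with hk
  have hkm : k ≤ m₀ := (Finset.card_le_card hCP).trans hPc
  let e : Fin k ≃ {x // x ∈ C} := (C.equivFin).symm
  refine ⟨k, fun i => (e i).1, fun i => ρ (e i).1, hkm, fun i => hPT (hCP (e i).2), fun i => ?_, ?_, ?_⟩
  · obtain ⟨h1, h2⟩ := hρ _ (e i).2
    refine ⟨h1, h2.trans ?_⟩
    have h7 : (0 : ℝ) ≤ 7 ^ m₀ * s := by positivity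
    linarith
  · intro x hx
    obtain ⟨p, hp, hxp⟩ : ∃ p ∈ P, x ∈ ball p s := by simpa only [mem_iUnion, exists_prop] using hnet hx
    obtain ⟨c, hc, hpc⟩ := hcov p hp
    refine mem_iUnion.2 ⟨e.symm ⟨c, hc⟩, ?_⟩
    have hec : (e (e.symm ⟨c, hc⟩)).1 = c := by rw [Equiv.apply_symm_apply]
    rw [mem_ball]
    simp only [hec]
    calc dist x c ≤ dist x p + dist p c := dist_triangle _ _ _
      _ < s + dist p c := by rw [mem_ball] at hxp; linarith
      _ ≤ ρ c := by linarith
  · intro i j hij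
    have hne : (e i).1 ≠ (e j).1 := fun h => hij (e.injective (Subtype.ext h))
    have hd := hdisj _ (e i).2 _ (e j).2 hne
    refine Set.disjoint_left.2 fun y hyi hyj => ?_
    rw [mem_ball] at hyi hyj
    have := dist_triangle (e i).1 y (e j).1
    rw [dist_comm] at hyi
    linarith

end DepletionLadder.KStar.BangBang

end Summit.NavierStokesRegularity.NavierStokesRegularity.Theorems
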